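import Summits.BirchSwinnertonDyer.BirchSwinnertonDyer.Theses.OneSidedTwistSqueezeX9
import HarnessLib

/-!
# Route OneSidedTwistSqueezeX9 — the Assembly item (stmt-BirchSwinnertonDyer-20549), PROVED

Cell `bsd-f3-mu` route (planner-of-record bsd-f3-mu-imc), landed by the adjacent cell `bsd-print-x9`, seat
`bsd-print-x9-p1` (prover p1, gen 2) on director-bsd's 16:30:04Z order (c) — the route's referee ref1 attached
the candidate proof `AssemblyProof.lean` on the item (referees do not land positives). The route's assembly
`Assembly := KatoDivisibilityX9 → Display53X9 → PublishedInputsX9 → SchneiderX9RankOne →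
Rank1Residual.BSDpOnClassX9` is ONE application of the landed squeeze kernel
`Summit.BirchSwinnertonDyer.Rank1Residual.SmallImageMu.bsdpOnClassX9_of_katoDivisibility_squeeze` (p537308,
`Rank1Residual/SmallImageMu/KatoDivisibilityEdges.lean`): the one-sided τ-free Kato divisibility on class X9
+ BCS display (5.3) + the published inputs ⟹ `IntegralMainConjectureOnClassX9` (exponent squeeze
`k₀ + k₁ + k₂ + k₃ ≥ 0`, `kᵢ ≤ 0`) ⟹ the leaf by `bsdpOnClassX9_of_integralMainConjectureOnClassX9` (+ the
Schneider rider on rank 1). HONEST STATUS: this closes the ASSEMBLY item only; the leaf `BSDpOnClassX9`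
stays conditional on the cruxes `KatoDivisibilityX9` (20547, open-problem grade) and `SchneiderX9RankOne`
(19631), on the cite-only display (5.3) (20548, BCS composite flag) and on `PublishedInputsX9`; BSD is not
proved here.
-/

namespace Summit.BirchSwinnertonDyer.Rank1Residual.SmallImageMu

/-- **Assembly of route OneSidedTwistSqueezeX9** (item stmt-BirchSwinnertonDyer-20549): the one-sided Kato
divisibility on class X9, BCS display (5.3), the published inputs `PublishedInputsX9` (BCS (a), Greenberg
Thm 4.1, period unit, Schneider 1985, Perrin-Riou, modularity, entire `L`, GZK) and Schneider's
non-degeneracy on the rank-`1` X9 pairs give the rung-K6 leaf `Rank1Residual.BSDpOnClassX9` — by the kernel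
theorem `SmallImageMu.bsdpOnClassX9_of_katoDivisibility_squeeze` (the route's `PublishedInputsX9` /
`SchneiderX9RankOne` unfold to the binder types of that theorem).
[cite: BurungaleCastellaSkinner2025, Thm. 1.1.2 (a) and display (5.3) (p. 10 of arXiv:2405.00270v2)]
[cite: GreenbergLNM1716, Thm. 4.1 (p. 102)] [cite: Miller2011LMS, §1 and Def. 1.1] -/
theorem oneSidedTwistSqueezeX9_assembly_proof :
    Summit.BirchSwinnertonDyer.BirchSwinnertonDyer.Theses.OneSidedTwistSqueezeX9.Assembly :=
  fun hC1 h53 hPub hC3 => bsdpOnClassX9_of_katoDivisibility_squeeze hC1 h53 hPub hC3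

end Summit.BirchSwinnertonDyer.Rank1Residual.SmallImageMu
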